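import Mathlib
import HarnessLib
import Summits.ValiantsHypothesis.ValiantsHypothesis.Theorems.LacunarySymmetroidMatrixDescartesProductPlusOneCoherentK

/-!
# ValiantsHypothesis / LacunarySymmetroid — crux `MatrixDescartes` (stmt-ValiantsHypothesis-18050, V1),
# LINE (A) «product_plus_one», S4″/S5 Euler currency: the LOWER-SIGNED SECTOR — calculus (the top-chart certificate)

A factor `f = Σ_l a_l X^{d_l}` on the common support `d_0 < d_1 < ⋯ < d_{K−1}` is LOWER-SIGNED when its coefficients BELOW THE TOP
LETTER are weakly one-signed (`a_l ≥ 0` for all `l < K−1`, or `a_l ≤ 0` for all `l < K−1`); the top coefficient is FREE: opposite sign =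
a coherent one-zero factor (✓ `…CoherentK`, p667023), same sign = a one-signed ZERO-FREE factor (✓ `…PosCoeff`, p646279), zero = a factor on the
lower support; zero coefficients are allowed anywhere.

MECHANISM — the TOP chart.  With the weight `w = d_{K−1} − d_0` (the TOP gap; ✓ `…CoherentK` uses `d_{K−2} − d_0`) put
`Ξ(x) = (X f′ − d_0 f)(x) / (x^w f(x))`; in the chart `t = x^w` this is `w·(d/dt) log |f/x^{d_0}|`, and `f/x^{d_0} = Σ_l a_l t^{δ_l/w}`
(`δ_l = d_l − d_0`, all exponents `≤ 1`) is CONCAVE in `t` for a lower-signed factor.  The certificate is the identity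
`4w²·(f·E − N₀²) = −(2w·N₀ + Q)² − Q·R₀` (`lowerSigned_certificate`), where `N₀ = Σ δ_l u_l`, `E = Σ δ_l(δ_l − w) u_l = −Q`,
`Q = Σ δ_l(w − δ_l) u_l`, `R₀ = Σ (w − δ_l)(4w − δ_l) u_l` (`u_l = a_l x^{d_l}`; from the termwise `4w²·f = 4w·N₀ + Q + R₀`,
`lowerSigned_linear_identity`): for lower-signed data `Q` and `R₀` have the same weak sign, so the bracket `f·E − N₀²` is `≤ 0`, and `< 0`
unless the data is a bottom monomial (`lowerSigned_bracket_of_nonneg`, `lowerSigned_bracket`).  Consequence: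

* ★ `hasDerivAt_lowerSignedXi` — for a lower-signed sparse factor (`T ≥ 1` letters above the bottom one, `d` strictly increasing) and every
  `x > 0` with `f(x) ≠ 0`: `Ξ` has a derivative `D ≤ 0` at `x`, and `D < 0` unless `f = a_0 X^{d_0}`.

The counts (`Z₊(eulerNumerator d a 0) ≤ 2m + 1`, members `≤ 2m + 2`, every format) are drawn in `…ProductPlusOneLowerSigned`.
(p7 g14's memo `NOTE-p7g14-18050-LINEA-K3-structure.md` §10 lists one-signed rows among the carriers of the interaction problem — in the top
chart they are tame.)  Honest framing: calculus of a sector rung of the research stubs; NOT `stub_eulerBoundK3` / `stub_classRowK3` /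
`stub_polyLaw` / `MatrixDescartes` / B; `VP ≠ VNP` NOT proved.  No definitions, no named facts.
-/

set_option linter.dupNamespace false

namespace Summit.ValiantsHypothesis.ValiantsHypothesis.Theorems.LacunarySymmetroidMatrixDescartes

namespace ProductPlusOne

open Polynomial Finset
open scoped BigOperators


/-! ### §A The certificate -/

/-- termwise: `4w²·Σ u = 4w·Σ δu + Σ δ(w−δ)u + Σ (w−δ)(4w−δ)u`. [folklore] -/
theorem lowerSigned_linear_identity (n : ℕ) (δ u : ℕ → ℝ) (w : ℝ) :
    4 * w ^ 2 * (∑ i ∈ range n, u i)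
      = 4 * w * (∑ i ∈ range n, δ i * u i) + (∑ i ∈ range n, δ i * (w - δ i) * u i)
        + ∑ i ∈ range n, (w - δ i) * (4 * w - δ i) * u i := by
  rw [Finset.mul_sum, Finset.mul_sum, ← Finset.sum_add_distrib, ← Finset.sum_add_distrib]
  exact Finset.sum_congr rfl fun i _ => by ring

/-- **The top-chart certificate**: `4w²·(S₀·E − N₀²) = −(2w·N₀ + Q)² − Q·R₀` with `S₀ = Σ u`, `N₀ = Σ δu`, `E = Σ δ(δ−w)u`,
`Q = Σ δ(w−δ)u`, `R₀ = Σ (w−δ)(4w−δ)u`. [this file's lemma] -/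
theorem lowerSigned_certificate (n : ℕ) (δ u : ℕ → ℝ) (w : ℝ) :
    4 * w ^ 2 * ((∑ i ∈ range n, u i) * (∑ i ∈ range n, δ i * (δ i - w) * u i) - (∑ i ∈ range n, δ i * u i) ^ 2)
      = -(2 * w * (∑ i ∈ range n, δ i * u i) + ∑ i ∈ range n, δ i * (w - δ i) * u i) ^ 2
        - (∑ i ∈ range n, δ i * (w - δ i) * u i) * (∑ i ∈ range n, (w - δ i) * (4 * w - δ i) * u i) := by
  have h := lowerSigned_linear_identity n δ u w
  have hE : (∑ i ∈ range n, δ i * (δ i - w) * u i) = -(∑ i ∈ range n, δ i * (w - δ i) * u i) := by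
    rw [← Finset.sum_neg_distrib]; exact Finset.sum_congr rfl fun i _ => by ring
  rw [hE]
  linear_combination (-(∑ i ∈ range n, δ i * (w - δ i) * u i)) * h

/-- **The bracket `S₀·E − N₀²` is nonpositive for lower-signed nonnegative data, negative unless the data is a bottom monomial.**
(`δ 0 = 0`, `δ T = w > 0`, `0 < δ i < w` for `0 < i < T`, `u i ≥ 0` for `i < T`, `u T` free.) [this file's lemma] -/
theorem lowerSigned_bracket_of_nonneg (T : ℕ) (δ u : ℕ → ℝ) (w : ℝ) (hw : 0 < w) (hδ0 : δ 0 = 0) (hδT : δ T = w)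
    (hδ : ∀ i, 0 < i → i < T → 0 < δ i ∧ δ i < w) (hu : ∀ i, i < T → 0 ≤ u i) :
    (∑ i ∈ range (T + 1), u i) * (∑ i ∈ range (T + 1), δ i * (δ i - w) * u i)
        - (∑ i ∈ range (T + 1), δ i * u i) ^ 2 ≤ 0 ∧
    ((∃ i, 0 < i ∧ i < T + 1 ∧ u i ≠ 0) →
      (∑ i ∈ range (T + 1), u i) * (∑ i ∈ range (T + 1), δ i * (δ i - w) * u i)
        - (∑ i ∈ range (T + 1), δ i * u i) ^ 2 < 0) := by
  have hcert := lowerSigned_certificate (T + 1) δ u w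
  set B := (∑ i ∈ range (T + 1), u i) * (∑ i ∈ range (T + 1), δ i * (δ i - w) * u i)
        - (∑ i ∈ range (T + 1), δ i * u i) ^ 2 with hB
  set Q := ∑ i ∈ range (T + 1), δ i * (w - δ i) * u i with hQ
  set R := ∑ i ∈ range (T + 1), (w - δ i) * (4 * w - δ i) * u i with hR
  set N := ∑ i ∈ range (T + 1), δ i * u i with hN
  -- coefficient signs
  have hκ : ∀ i, i < T + 1 → 0 ≤ δ i * (w - δ i) := by
    intro i hi
    rcases Nat.eq_zero_or_pos i with h0 | hpos
    · rw [h0, hδ0]; simp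
    · rcases Nat.lt_or_ge i T with hlt | hge
      · have := hδ i hpos hlt; nlinarith
      · have hiT : i = T := by omega
        rw [hiT, hδT]; simp
  have hρ : ∀ i, i < T + 1 → 0 ≤ (w - δ i) * (4 * w - δ i) := by
    intro i hi
    rcases Nat.eq_zero_or_pos i with h0 | hpos
    · rw [h0, hδ0]; nlinarith
    · rcases Nat.lt_or_ge i T with hlt | hge
      · have := hδ i hpos hlt; nlinarith
      · have hiT : i = T := by omega
        rw [hiT, hδT]; simp
  -- the top term of `Q` and `R` vanishes, the others are nonnegative
  have hQterm : ∀ i ∈ range (T + 1), 0 ≤ δ i * (w - δ i) * u i := by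
    intro i hi
    rw [Finset.mem_range] at hi
    rcases Nat.lt_or_ge i T with hlt | hge
    · exact mul_nonneg (hκ i hi) (hu i hlt)
    · have hiT : i = T := by omega
      rw [hiT, hδT]; simp
  have hRterm : ∀ i ∈ range (T + 1), 0 ≤ (w - δ i) * (4 * w - δ i) * u i := by
    intro i hi
    rw [Finset.mem_range] at hi
    rcases Nat.lt_or_ge i T with hlt | hge
    · exact mul_nonneg (hρ i hi) (hu i hlt)
    · have hiT : i = T := by omega
      rw [hiT, hδT]; simp
  have hQ0 : 0 ≤ Q := Finset.sum_nonneg hQterm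
  have hR0 : 0 ≤ R := Finset.sum_nonneg hRterm
  have hw2 : 0 < 4 * w ^ 2 := by positivity
  have hB0 : B ≤ 0 := by
    have h1 : 4 * w ^ 2 * B ≤ 0 := by
      rw [hcert]; nlinarith [sq_nonneg (2 * w * N + Q), mul_nonneg hQ0 hR0]
    by_contra hcon
    push Not at hcon
    nlinarith
  refine ⟨hB0, fun ⟨i₀, hi₀0, hi₀T, hui₀⟩ => ?_⟩
  by_cases hmid : ∃ i, 0 < i ∧ i < T ∧ u i ≠ 0
  · -- a middle term is present: `Q > 0` and `R > 0`
    obtain ⟨i₁, hi₁0, hi₁T, hui₁⟩ := hmid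
    have hu1 : 0 < u i₁ := lt_of_le_of_ne (hu i₁ hi₁T) (Ne.symm hui₁)
    have hδ1 := hδ i₁ hi₁0 hi₁T
    have hmem : i₁ ∈ range (T + 1) := Finset.mem_range.2 (by omega)
    have hQpos : 0 < Q := by
      have hle := Finset.single_le_sum hQterm hmem
      have hlt : 0 < δ i₁ * (w - δ i₁) * u i₁ := by
        have : 0 < δ i₁ * (w - δ i₁) := by nlinarith
        exact mul_pos this hu1
      exact lt_of_lt_of_le hlt hle
    have hRpos : 0 < R := by
      have hle := Finset.single_le_sum hRterm hmem
      have hlt : 0 < (w - δ i₁) * (4 * w - δ i₁) * u i₁ := by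
        have : 0 < (w - δ i₁) * (4 * w - δ i₁) := by nlinarith
        exact mul_pos this hu1
      exact lt_of_lt_of_le hlt hle
    have h1 : 4 * w ^ 2 * B < 0 := by
      rw [hcert]; nlinarith [sq_nonneg (2 * w * N + Q), mul_pos hQpos hRpos]
    by_contra hcon
    push Not at hcon
    nlinarith
  · -- no middle term: the data is `u 0` at the bottom and `u T ≠ 0` at the top; `Q = 0`, `N = w · u T`
    push Not at hmid
    have hi₀ : i₀ = T := by
      by_contra hne
      exact hui₀ (hmid i₀ hi₀0 (by omega))
    have huT : u T ≠ 0 := hi₀ ▸ hui₀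
    have hTpos : 0 < T := by omega
    have hQz : Q = 0 := by
      refine Finset.sum_eq_zero fun i hi => ?_
      rw [Finset.mem_range] at hi
      rcases Nat.eq_zero_or_pos i with h0 | hpos
      · rw [h0, hδ0]; simp
      · rcases Nat.lt_or_ge i T with hlt | hge
        · rw [hmid i hpos hlt]; simp
        · have hiT : i = T := by omega
          rw [hiT, hδT]; simp
    have hNz : N = w * u T := by
      rw [hN, Finset.sum_range_succ, hδT]
      have : ∑ i ∈ range T, δ i * u i = 0 := by
        refine Finset.sum_eq_zero fun i hi => ?_
        rw [Finset.mem_range] at hi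
        rcases Nat.eq_zero_or_pos i with h0 | hpos
        · rw [h0, hδ0]; simp
        · rw [hmid i hpos hi]; simp
      rw [this, zero_add]
    have hsq : 0 < (2 * w * N + Q) ^ 2 := by
      rw [hQz, hNz, add_zero]
      have : 2 * w * (w * u T) ≠ 0 := by
        apply mul_ne_zero (mul_ne_zero two_ne_zero hw.ne') (mul_ne_zero hw.ne' huT)
      positivity
    have hQR : Q * R = 0 := by rw [hQz, zero_mul]
    have h1 : 4 * w ^ 2 * B < 0 := by
      rw [hcert, hQR]; linarith [hsq]
    by_contra hcon
    push Not at hcon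
    nlinarith

/-- **The bracket for lower-signed data of either sign** (reduction `u ↦ −u`). [this file's lemma] -/
theorem lowerSigned_bracket (T : ℕ) (δ u : ℕ → ℝ) (w : ℝ) (hw : 0 < w) (hδ0 : δ 0 = 0) (hδT : δ T = w)
    (hδ : ∀ i, 0 < i → i < T → 0 < δ i ∧ δ i < w) (hu : (∀ i, i < T → 0 ≤ u i) ∨ (∀ i, i < T → u i ≤ 0)) :
    (∑ i ∈ range (T + 1), u i) * (∑ i ∈ range (T + 1), δ i * (δ i - w) * u i)
        - (∑ i ∈ range (T + 1), δ i * u i) ^ 2 ≤ 0 ∧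
    ((∃ i, 0 < i ∧ i < T + 1 ∧ u i ≠ 0) →
      (∑ i ∈ range (T + 1), u i) * (∑ i ∈ range (T + 1), δ i * (δ i - w) * u i)
        - (∑ i ∈ range (T + 1), δ i * u i) ^ 2 < 0) := by
  rcases hu with hu | hu
  · exact lowerSigned_bracket_of_nonneg T δ u w hw hδ0 hδT hδ hu
  · -- apply the nonnegative case to `−u`; the bracket is even in `u`
    have h := lowerSigned_bracket_of_nonneg T δ (fun i => -u i) w hw hδ0 hδT hδ (fun i hi => by simpa using hu i hi)
    have e1 : (∑ i ∈ range (T + 1), -u i) = -∑ i ∈ range (T + 1), u i := Finset.sum_neg_distrib ..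
    have e2 : (∑ i ∈ range (T + 1), δ i * (δ i - w) * -u i) = -∑ i ∈ range (T + 1), δ i * (δ i - w) * u i := by
      rw [← Finset.sum_neg_distrib]; exact Finset.sum_congr rfl fun i _ => by ring
    have e3 : (∑ i ∈ range (T + 1), δ i * -u i) = -∑ i ∈ range (T + 1), δ i * u i := by
      rw [← Finset.sum_neg_distrib]; exact Finset.sum_congr rfl fun i _ => by ring
    simp only [e1, e2, e3, neg_mul_neg, neg_sq] at h
    refine ⟨h.1, fun ⟨i, hi0, hiT, hui⟩ => h.2 ⟨i, hi0, hiT, by simpa using hui⟩⟩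

/-! ### §B The derivative of `Ξ = (X f′ − d₀ f)/(x^w f)`, `w = d_T − d_0`, is nonpositive for a lower-signed factor -/

/-- ★ For a LOWER-SIGNED sparse factor `f = Σ_{i ≤ T} c_i X^{d_i}` (`T ≥ 1`, `d` strictly increasing, `c_i` weakly one-signed for `i < T`,
`c_T` free) and the top weight `w = d_T − d_0`: at every `x > 0` with `f(x) ≠ 0`, `Ξ(y) = (X f′ − d_0 f)(y)/(y^w f(y))` has a NONPOSITIVE
derivative, NEGATIVE unless `f = c_0 X^{d_0}`. [this file's theorem] -/
theorem hasDerivAt_lowerSignedXi (T : ℕ) (hT : 1 ≤ T) (d : ℕ → ℕ) (hd : StrictMono d) (c : ℕ → ℝ)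
    (hls : (∀ i, i < T → 0 ≤ c i) ∨ (∀ i, i < T → c i ≤ 0)) {x : ℝ} (hx : 0 < x)
    (hf : (∑ i ∈ Finset.range (T + 1), C (c i) * X ^ (d i) : ℝ[X]).eval x ≠ 0) :
    ∃ D : ℝ, D ≤ 0 ∧ ((∃ i, 0 < i ∧ i < T + 1 ∧ c i ≠ 0) → D < 0) ∧ HasDerivAt (fun y : ℝ =>
      (X * derivative (∑ i ∈ Finset.range (T + 1), C (c i) * X ^ (d i) : ℝ[X])
          - C ((d 0 : ℕ) : ℝ) * ∑ i ∈ Finset.range (T + 1), C (c i) * X ^ (d i)).eval y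
        / (y ^ (d T - d 0) * (∑ i ∈ Finset.range (T + 1), C (c i) * X ^ (d i) : ℝ[X]).eval y)) D x := by
  classical
  set f : ℝ[X] := ∑ i ∈ Finset.range (T + 1), C (c i) * X ^ (d i) with hfdef
  set N₀ : ℝ[X] := X * derivative f - C ((d 0 : ℕ) : ℝ) * f with hN₀
  set w : ℕ := d T - d 0 with hw
  have hd0T : d 0 < d T := hd (by omega)
  have hwR : (w : ℝ) = (d T : ℝ) - d 0 := by rw [hw, Nat.cast_sub hd0T.le]
  have hwpos : (0 : ℝ) < w := by
    have := (Nat.cast_lt.2 hd0T : ((d 0 : ℕ) : ℝ) < _)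
    rw [hwR]; linarith
  have hV : x ^ w * f.eval x ≠ 0 := mul_ne_zero (pow_ne_zero _ hx.ne') hf
  have hnum : HasDerivAt (fun y : ℝ => N₀.eval y) ((derivative N₀).eval x) x := N₀.hasDerivAt x
  have hden : HasDerivAt (fun y : ℝ => y ^ w * f.eval y) (((w : ℕ) : ℝ) * x ^ (w - 1) * f.eval x + x ^ w * (derivative f).eval x) x :=
    (hasDerivAt_pow w x).mul (f.hasDerivAt x)
  -- sparse forms
  have hN₀s : N₀ = ∑ i ∈ Finset.range (T + 1), C (c i * ((d i : ℝ) - d 0)) * X ^ (d i) := by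
    rw [hN₀, hfdef]; exact euler_sparse (T + 1) d c _
  have hEs : X * derivative N₀ - C (((w : ℕ) : ℝ) + d 0) * N₀
      = ∑ i ∈ Finset.range (T + 1), C (c i * ((d i : ℝ) - d 0) * ((d i : ℝ) - ((w : ℝ) + d 0))) * X ^ (d i) := by
    rw [hN₀s]; exact euler_sparse (T + 1) d (fun i => c i * ((d i : ℝ) - d 0)) _
  have hXf : x * (derivative f).eval x = N₀.eval x + (d 0 : ℝ) * f.eval x := by
    simp only [hN₀, eval_sub, eval_mul, eval_C, eval_X]; ring
  have evf : f.eval x = ∑ i ∈ Finset.range (T + 1), c i * x ^ (d i) := by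
    rw [hfdef]; simp only [eval_finsetSum, eval_mul, eval_C, eval_pow, eval_X]
  have evN : N₀.eval x = ∑ i ∈ Finset.range (T + 1), ((d i : ℝ) - d 0) * (c i * x ^ (d i)) := by
    rw [hN₀s]; simp only [eval_finsetSum, eval_mul, eval_C, eval_pow, eval_X]
    exact Finset.sum_congr rfl fun i _ => by ring
  have evE : (X * derivative N₀ - C (((w : ℕ) : ℝ) + d 0) * N₀).eval x
      = ∑ i ∈ Finset.range (T + 1), ((d i : ℝ) - d 0) * (((d i : ℝ) - d 0) - w) * (c i * x ^ (d i)) := by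
    rw [hEs]; simp only [eval_finsetSum, eval_mul, eval_C, eval_pow, eval_X]
    exact Finset.sum_congr rfl fun i _ => by ring
  have evE' : (X * derivative N₀ - C (((w : ℕ) : ℝ) + d 0) * N₀).eval x
      = x * (derivative N₀).eval x - ((w : ℝ) + d 0) * N₀.eval x := by
    simp only [eval_sub, eval_mul, eval_C, eval_X]
  -- `x · numerator = x^w · (f·E − N₀²)`
  have hkx : x * (((w : ℕ) : ℝ) * x ^ (w - 1)) = (w : ℝ) * x ^ w := by
    rcases Nat.eq_zero_or_pos w with h0 | hpos
    · rw [h0]; simp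
    · rw [← Nat.sub_add_cancel hpos]; simp [pow_succ]; ring
  have hid : x * ((derivative N₀).eval x * (x ^ w * f.eval x)
        - N₀.eval x * (((w : ℕ) : ℝ) * x ^ (w - 1) * f.eval x + x ^ w * (derivative f).eval x))
      = x ^ w * (f.eval x * (X * derivative N₀ - C (((w : ℕ) : ℝ) + d 0) * N₀).eval x - (N₀.eval x) ^ 2) := by
    rw [evE']
    linear_combination (-(N₀.eval x) * f.eval x) * hkx + (-(N₀.eval x) * x ^ w) * hXf
  -- the bracket is the lower-signed form
  have hbr := lowerSigned_bracket T (fun i => (d i : ℝ) - d 0) (fun i => c i * x ^ (d i)) (w : ℝ) hwpos (by simp)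
    (by simp [hwR])
    (by
      intro i hi0 hiT
      constructor
      · have hlt : d 0 < d i := hd hi0
        have := (Nat.cast_lt.2 hlt : ((d 0 : ℕ) : ℝ) < _)
        linarith
      · have hlt : d i < d T := hd hiT
        have := (Nat.cast_lt.2 hlt : ((d i : ℕ) : ℝ) < _)
        rw [hwR]; linarith)
    (by
      rcases hls with h | h
      · exact Or.inl fun i hi => mul_nonneg (h i hi) (pow_pos hx _).le
      · exact Or.inr fun i hi => mul_nonpos_of_nonpos_of_nonneg (h i hi) (pow_pos hx _).le)
  have hbr' : f.eval x * (X * derivative N₀ - C (((w : ℕ) : ℝ) + d 0) * N₀).eval x - (N₀.eval x) ^ 2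
      = (∑ i ∈ range (T + 1), c i * x ^ (d i)) * (∑ i ∈ range (T + 1), ((d i : ℝ) - d 0) * (((d i : ℝ) - d 0) - w) * (c i * x ^ (d i)))
        - (∑ i ∈ range (T + 1), ((d i : ℝ) - d 0) * (c i * x ^ (d i))) ^ 2 := by
    rw [evf, evN, evE]
  have hxw : 0 < x ^ w := pow_pos hx _
  set num := (derivative N₀).eval x * (x ^ w * f.eval x)
        - N₀.eval x * (((w : ℕ) : ℝ) * x ^ (w - 1) * f.eval x + x ^ w * (derivative f).eval x) with hnumdef
  have hnum_le : num ≤ 0 := by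
    have h1 : x * num ≤ 0 := by
      rw [hid, hbr']; exact mul_nonpos_of_nonneg_of_nonpos hxw.le hbr.1
    by_contra hcon
    push Not at hcon
    exact absurd h1 (not_le.2 (mul_pos hx hcon))
  have hnum_lt : (∃ i, 0 < i ∧ i < T + 1 ∧ c i ≠ 0) → num < 0 := by
    rintro ⟨i, hi0, hiT, hci⟩
    have hstrict := hbr.2 ⟨i, hi0, hiT, mul_ne_zero hci (pow_ne_zero _ hx.ne')⟩
    have h1 : x * num < 0 := by
      rw [hid, hbr']; exact mul_neg_of_pos_of_neg hxw hstrict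
    by_contra hcon
    push Not at hcon
    exact absurd h1 (not_lt.2 (mul_nonneg hx.le hcon))
  have hsq : 0 < (x ^ w * f.eval x) ^ 2 := by positivity
  refine ⟨num / (x ^ w * f.eval x) ^ 2, div_nonpos_of_nonpos_of_nonneg hnum_le hsq.le,
    fun h => div_neg_of_neg_of_pos (hnum_lt h) hsq, ?_⟩
  exact hnum.div hden hV


end ProductPlusOne

end Summit.ValiantsHypothesis.ValiantsHypothesis.Theorems.LacunarySymmetroidMatrixDescartes
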